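import Mathlib
import Summits.Ventures.PercRepro2.SwOutCrossJunctionSw

/-!
# A second instance of Theorem A_cross: a triangle of dropped vertices, a far arm, the mark in
the u-arm (blind cell PercRepro2, night-4 g24, 2026-08-28; proofs/NIGHT4-G24.md §8)

The graph `crossEx3` on `Fin 8` (`l = 0`, `h = 1`, the mark `o = 2` IN THE u-ARM (edges `ho`,
`uo`, no outside edge), the junction `u = 3`, the dropped vertices `p₁ = 4`, `p₂ = 5`, `p₃ = 6`
forming a TRIANGLE of cross edges, the far arm `f = 7`) with thirteen edges; the cross-edge graph
is `⊤` on `Fin 3`.  **Row (SW) holds** (`sw_crossEx3`) by `sw_of_crossJunction`.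
-/

namespace Summit.Ventures.PercRepro2

namespace CrossArm

open Hull LocRows

open scoped Classical

/-- The triangle junction: `l = 0`, `h = 1`, `o = 2`, `u = 3`, `p₁ p₂ p₃ = 4 5 6`, `f = 7`. -/
def crossEx3 : Fin 13 → Sym2 (Fin 8)
  | 0 => s(1, 2) | 1 => s(3, 2) | 2 => s(3, 4) | 3 => s(3, 5) | 4 => s(3, 6) | 5 => s(4, 5)
  | 6 => s(5, 6) | 7 => s(4, 6) | 8 => s(1, 7) | 9 => s(7, 0) | 10 => s(4, 0) | 11 => s(5, 0)
  | 12 => s(6, 0)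

/-- The three dropped vertices. -/
def crossEx3P : Fin 3 → Fin 8 := ![4, 5, 6]

/-- An edge with no end at `c` is not an edge at `c`. -/
lemma crossEx3_no_edge_at {a b c x : Fin 8} (h : s(a, b) = s(c, x)) (ha : a ≠ c) (hb : b ≠ c) :
    False := by
  rw [Sym2.eq_iff] at h
  rcases h with ⟨h1, _⟩ | ⟨_, h2⟩
  · exact ha h1
  · exact hb h2

/-- The other end of an edge at `a`. -/
lemma crossEx3_eq_of_edge {a b x : Fin 8} (h : s(a, b) = s(a, x)) (hab : b ≠ a) : x = b := by
  rw [Sym2.eq_iff] at h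
  rcases h with ⟨_, h2⟩ | ⟨h1, h2⟩
  · exact h2.symm
  · exact absurd h2 hab

/-- The cross junction of `crossEx3`. -/
theorem crossEx3_junction :
    CrossJunction crossEx3 ({0}ᶜ) 1 3 crossEx3P (⊤ : SimpleGraph (Fin 3)) 2 where
  hne_hu := by decide
  hne_hp := by decide
  hne_up := by decide
  p_inj := by decide
  hou := by decide
  hop := by decide
  hhU := by simp
  huU := by simp
  hpU := by intro i; fin_cases i <;> simp [crossEx3P]
  hloop_h := by intro e; fin_cases e <;> decide
  hloop_u := by intro e; fin_cases e <;> decide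
  hnadj := by intro e; fin_cases e <;> decide
  hnadj_p := by intro i e; fin_cases i <;> fin_cases e <;> decide
  hup := by
    intro i
    fin_cases i
    · exact ⟨2, rfl⟩
    · exact ⟨3, rfl⟩
    · exact ⟨4, rfl⟩
  hcross := by
    intro i j hij
    fin_cases i <;> fin_cases j
    · exact absurd hij (by decide)
    · exact ⟨5, rfl⟩
    · exact ⟨7, rfl⟩
    · exact ⟨5, by decide⟩
    · exact absurd hij (by decide)
    · exact ⟨6, rfl⟩
    · exact ⟨7, by decide⟩
    · exact ⟨6, by decide⟩
    · exact absurd hij (by decide)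
  hcross_adj := by
    intro i j e
    revert e
    fin_cases i <;> fin_cases j <;> decide
  hcross_simple := by
    intro i j e e'
    revert e e'
    fin_cases i <;> fin_cases j <;> decide
  hu_adj_h := by
    intro e x he hx
    fin_cases e <;> simp only [crossEx3] at he
    · exact (crossEx3_no_edge_at he (by decide) (by decide)).elim
    · obtain rfl := crossEx3_eq_of_edge he (by decide)
      exact ⟨0, by decide⟩
    · obtain rfl := crossEx3_eq_of_edge he (by decide)
      exact absurd rfl (hx 0)
    · obtain rfl := crossEx3_eq_of_edge he (by decide)
      exact absurd rfl (hx 1)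
    · obtain rfl := crossEx3_eq_of_edge he (by decide)
      exact absurd rfl (hx 2)
    all_goals exact (crossEx3_no_edge_at he (by decide) (by decide)).elim
  hp_in := by
    intro i e x he hxU
    fin_cases i <;> simp only [crossEx3P] at he <;> fin_cases e <;> simp only [crossEx3] at he
    all_goals first
      | exact (crossEx3_no_edge_at he (by decide) (by decide)).elim
      | (rw [Sym2.eq_swap] at he; obtain rfl := crossEx3_eq_of_edge he (by decide); exact Or.inl rfl)
      | (obtain rfl := crossEx3_eq_of_edge he (by decide); exact Or.inr ⟨1, rfl⟩)
      | (obtain rfl := crossEx3_eq_of_edge he (by decide); exact Or.inr ⟨2, rfl⟩)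
      | (rw [Sym2.eq_swap] at he; obtain rfl := crossEx3_eq_of_edge he (by decide);
          exact Or.inr ⟨0, rfl⟩)
      | (rw [Sym2.eq_swap] at he; obtain rfl := crossEx3_eq_of_edge he (by decide);
          exact Or.inr ⟨1, rfl⟩)
      | (obtain rfl := crossEx3_eq_of_edge he (by decide); simp at hxU)
  hout := by
    intro x hx hx1 hx2 hx3
    simp only [Set.mem_compl_iff, Set.mem_singleton_iff] at hx
    fin_cases x
    · exact absurd rfl hx
    · exact absurd rfl hx1
    · exact absurd rfl hx2
    · exact absurd rfl hx3
    · exact Or.inl ⟨10, 0, rfl, by simp⟩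
    · exact Or.inl ⟨11, 0, rfl, by simp⟩
    · exact Or.inl ⟨12, 0, rfl, by simp⟩
    · exact Or.inl ⟨9, 0, rfl, by simp⟩

/-- **Row (SW) on a junction with a triangle of dropped vertices, a far arm and the mark in the
u-arm.** -/
theorem sw_crossEx3 : Sw crossEx3 0 1 2 :=
  sw_of_crossJunction (by decide) crossEx3_junction SimpleGraph.connected_top

end CrossArm

end Summit.Ventures.PercRepro2
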